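import Summits.HubbardSuperconductivity.HubbardSuperconductivity.Theses.ChiralWindow

/-!
# Crux `CwKLChiralWindow` (item `stmt-HubbardSuperconductivity-1741`): channel structure behind clauses (i)–(iv)

`--supports` file of the standing disprover (cdisprove cycle 1, 2026-08-16); no definition introduced.
Generic facts about the tree's Kohn–Luttinger vocabulary (`KohnLuttinger.lean`) that every line on this
crux uses and that the disproof analysis (`Cruxes/CwKLChiralWindow/Disproof.lean`) rests on:

* `pairingForm_eq_sq_mul`, `channelInf_eq_sq_mul` — for mean-zero, kernel-integrable gap functions the
  bare-`U` term drops and `pairingForm` / `channelInf` are EXACTLY `U²`-homogeneous: clauses (i)–(iii) of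
  the crux are `U`-free inequalities between second-order channel bottoms for every `χ ≠ A1g`
  ("the margins `∝ U²` buy nothing");
* `sum_d4` and the `d4_*` evaluation lemmas — the isotypic projector `d4Project` unfolded over the eight
  elements of `DihedralGroup 4`;
* `b1g_diag`, `b1g_antidiag`, `b2g_axis`, `a2g_diag_axis`, `b1g_a2g_common_node`, `e_iff_odd` — the
  symmetry-forced zeros behind the node-covering clause (iv): B₁g vanishes on both diagonals, B₂g on both
  axes, A₂g on both (so `{B1g, A2g}` always share the diagonal Fermi points — the content of the crux's
  exclusion `χs ≠ A2g`), and the E channel is exactly the odd gap functions (no forced zero on the Fermi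
  curve; the singlet kernel acts on it as the triplet kernel).
-/

set_option linter.dupNamespace false

noncomputable section

namespace Summit.HubbardSuperconductivity.HubbardSuperconductivity.Theorems.CwKLChiralWindow.Negative

open Literature.MathematicalPhysics.QuantumLattice MeasureTheory
open scoped BigOperators

/-- For a mean-zero gap function the bare-`U` term drops out and the pairing form is EXACTLY
`U²`-homogeneous (hypotheses: integrability of `ψ` and of the kernel slices against `μ_F`, which hold
for every channel state at the window fillings since `μ_F` is finite and `χ₀` bounded there).
[folklore] -/
theorem pairingForm_eq_sq_mul {ε : Momentum → ℝ} {μ U : ℝ} {ψ : Momentum → ℝ}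
    (hψ : Integrable ψ (fermiCurveMeasure ε μ))
    (hχ : ∀ k, Integrable (fun k' => lindhardFunction ε μ (k + k') * ψ k') (fermiCurveMeasure ε μ))
    (h0 : ∫ k, ψ k ∂fermiCurveMeasure ε μ = 0) :
    pairingForm ε μ U ψ =
      U ^ 2 * ∫ k, ψ k * ∫ k', lindhardFunction ε μ (k + k') * ψ k' ∂fermiCurveMeasure ε μ
        ∂fermiCurveMeasure ε μ := by
  unfold pairingForm
  have inner : ∀ k, ∫ k', kohnLuttingerKernel ε μ U k k' * ψ k' ∂fermiCurveMeasure ε μ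
      = U ^ 2 * ∫ k', lindhardFunction ε μ (k + k') * ψ k' ∂fermiCurveMeasure ε μ := by
    intro k
    have hsplit : (fun k' => kohnLuttingerKernel ε μ U k k' * ψ k')
        = fun k' => U * ψ k' + U ^ 2 * (lindhardFunction ε μ (k + k') * ψ k') := by
      funext k'; simp only [kohnLuttingerKernel]; ring
    rw [hsplit, integral_add (hψ.const_mul U) ((hχ k).const_mul (U ^ 2)), integral_const_mul,
      integral_const_mul, h0, mul_zero, zero_add]
  simp_rw [inner]
  rw [← integral_const_mul]
  congr 1
  funext k
  ring

/-- Consequence ("the margins `∝ U²` buy nothing"): on any channel all of whose states are mean-zero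
and kernel-integrable — every `χ ≠ A1g` at the window fillings (`∫ψ dμ_F = ⟨1, ψ⟩ = 0` by
`D₄`-invariance of `μ_F`, `1 ∈ A1g`) — `channelInf` is exactly `U²`-homogeneous, so clauses
(i)–(iii) of the crux are `U`-FREE inequalities between the second-order bottoms
`m_χ(δ) := channelInf ε₀ (μ δ) 1 χ`; only the `A1g` comparisons retain a (monotone, harmless)
`U`-dependence. [folklore] -/
theorem channelInf_eq_sq_mul {ε : Momentum → ℝ} {μ : ℝ} (U : ℝ) (χ : D4Irrep)
    (hint : ∀ ψ, IsChannelState ε μ χ ψ → Integrable ψ (fermiCurveMeasure ε μ) ∧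
      (∀ k, Integrable (fun k' => lindhardFunction ε μ (k + k') * ψ k') (fermiCurveMeasure ε μ)) ∧
      ∫ k, ψ k ∂fermiCurveMeasure ε μ = 0) :
    channelInf ε μ U χ = U ^ 2 * channelInf ε μ 1 χ := by
  unfold channelInf
  have himg : (pairingForm ε μ U) '' {ψ | IsChannelState ε μ χ ψ}
      = (fun x => U ^ 2 * x) '' ((pairingForm ε μ 1) '' {ψ | IsChannelState ε μ χ ψ}) := by
    rw [Set.image_image]
    apply Set.image_congr
    intro ψ hψ
    obtain ⟨h1, h2, h3⟩ := hint ψ hψ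
    show pairingForm ε μ U ψ = U ^ 2 * pairingForm ε μ 1 ψ
    rw [pairingForm_eq_sq_mul h1 h2 h3, pairingForm_eq_sq_mul h1 h2 h3]
    ring
  rw [himg]
  have hnn : 0 ≤ U ^ 2 := sq_nonneg U
  rw [← smul_eq_mul, ← Real.sInf_smul_of_nonneg hnn]
  congr 1


/-- A sum over `DihedralGroup 4` unfolded over its eight elements `r 0 … r 3, sr 0 … sr 3`. [folklore] -/
theorem sum_d4 (f : DihedralGroup 4 → ℝ) :
    ∑ γ, f γ = (f (.r 0) + f (.r 1) + f (.r 2) + f (.r 3)) +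
      (f (.sr 0) + f (.sr 1) + f (.sr 2) + f (.sr 3)) := by
  rw [Fintype.sum_equiv DihedralGroup.equivSum f (fun x => f (DihedralGroup.equivSum.symm x))
    (by intro a; rcases a with j | j <;> rfl)]
  rw [Fintype.sum_sum_type]
  simp only [DihedralGroup.equivSum_symm_apply]
  have h4 : ∀ g : ZMod 4 → ℝ, ∑ i, g i = g 0 + g 1 + g 2 + g 3 := fun g => Fin.sum_univ_four g
  rw [h4, h4]

/-- `d4Momentum (r 0)` is the identity. [folklore] -/
theorem d4_r0 (k : Momentum) : d4Momentum (.r 0) k = k := rfl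
/-- `d4Momentum (r 1)` is the rotation by `π/2`. [folklore] -/
theorem d4_r1 (k : Momentum) : d4Momentum (.r 1) k = rotMomentum k := rfl
/-- `d4Momentum (r 2)` is the rotation by `π`. [folklore] -/
theorem d4_r2 (k : Momentum) : d4Momentum (.r 2) k = rotMomentum (rotMomentum k) := rfl
/-- `d4Momentum (r 3)` is the rotation by `3π/2`. [folklore] -/
theorem d4_r3 (k : Momentum) :
    d4Momentum (.r 3) k = rotMomentum (rotMomentum (rotMomentum k)) := rfl
/-- `d4Momentum (sr 0)` is the axis reflection. [folklore] -/
theorem d4_sr0 (k : Momentum) : d4Momentum (.sr 0) k = reflMomentum k := rfl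
/-- `d4Momentum (sr 1)` is reflection after one rotation. [folklore] -/
theorem d4_sr1 (k : Momentum) : d4Momentum (.sr 1) k = reflMomentum (rotMomentum k) := rfl
/-- `d4Momentum (sr 2)` is reflection after two rotations. [folklore] -/
theorem d4_sr2 (k : Momentum) :
    d4Momentum (.sr 2) k = reflMomentum (rotMomentum (rotMomentum k)) := rfl
/-- `d4Momentum (sr 3)` is reflection after three rotations (the diagonal reflection). [folklore] -/
theorem d4_sr3 (k : Momentum) :
    d4Momentum (.sr 3) k = reflMomentum (rotMomentum (rotMomentum (rotMomentum k))) := rfl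

/-- `(0 : ZMod 4).val = 0`. [folklore] -/
theorem val0 : (0 : ZMod 4).val = 0 := rfl
/-- `(1 : ZMod 4).val = 1`. [folklore] -/
theorem val1 : (1 : ZMod 4).val = 1 := rfl
/-- `(2 : ZMod 4).val = 2`. [folklore] -/
theorem val2 : (2 : ZMod 4).val = 2 := rfl
/-- `(3 : ZMod 4).val = 3`. [folklore] -/
theorem val3 : (3 : ZMod 4).val = 3 := rfl
/-- `1 ≠ 0` in `ZMod 4`. [folklore] -/
theorem ne10 : (1 : ZMod 4) ≠ 0 := by decide
/-- `1 ≠ 2` in `ZMod 4`. [folklore] -/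
theorem ne12 : (1 : ZMod 4) ≠ 2 := by decide
/-- `2 ≠ 0` in `ZMod 4`. [folklore] -/
theorem ne20 : (2 : ZMod 4) ≠ 0 := by decide
/-- `3 ≠ 0` in `ZMod 4`. [folklore] -/
theorem ne30 : (3 : ZMod 4) ≠ 0 := by decide
/-- `3 ≠ 2` in `ZMod 4`. [folklore] -/
theorem ne32 : (3 : ZMod 4) ≠ 2 := by decide

/-- The rotation on an explicit momentum `(a, b) ↦ (-b, a)`. [folklore] -/
theorem rot_mk (a b : ℝ) : rotMomentum (WithLp.toLp 2 ![a, b]) = WithLp.toLp 2 ![-b, a] := by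
  simp [rotMomentum]
/-- The reflection on an explicit momentum `(a, b) ↦ (a, -b)`. [folklore] -/
theorem refl_mk (a b : ℝ) : reflMomentum (WithLp.toLp 2 ![a, b]) = WithLp.toLp 2 ![a, -b] := by
  simp [reflMomentum]
/-- Two rotations are the inversion `k ↦ -k`. [folklore] -/
theorem rot_rot (k : Momentum) : rotMomentum (rotMomentum k) = -k := by
  ext i; fin_cases i <;> simp [rotMomentum]

/-- B₁g gap functions vanish on the zone diagonal `k₀ = k₁` (pointwise, for EVERY `InChannel .B1g`
function, not only a.e.): the four diagonal Fermi points are nodes of `g` in clause (iv).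
[folklore] -/
theorem b1g_diag {g : Momentum → ℝ} (h : InChannel .B1g g) (t : ℝ) :
    g (WithLp.toLp 2 ![t, t]) = 0 := by
  have := congrFun h (WithLp.toLp 2 ![t, t])
  simp only [d4Project, sum_d4, d4_r0, d4_r1, d4_r2, d4_r3, d4_sr0, d4_sr1, d4_sr2, d4_sr3,
    D4Irrep.char, D4Irrep.dim, val0, val1, val2, val3, rot_mk, refl_mk, neg_neg] at this
  norm_num at this
  linarith

/-- B₁g gap functions vanish on the anti-diagonal `k₁ = -k₀`. [folklore] -/
theorem b1g_antidiag {g : Momentum → ℝ} (h : InChannel .B1g g) (t : ℝ) :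
    g (WithLp.toLp 2 ![t, -t]) = 0 := by
  have := congrFun h (WithLp.toLp 2 ![t, -t])
  simp only [d4Project, sum_d4, d4_r0, d4_r1, d4_r2, d4_r3, d4_sr0, d4_sr1, d4_sr2, d4_sr3,
    D4Irrep.char, D4Irrep.dim, val0, val1, val2, val3, rot_mk, refl_mk, neg_neg] at this
  norm_num at this
  linarith

/-- B₂g (`d_xy`) gap functions vanish on both axes — where B₁g does not have forced zeros, so the
pair `{B1g, B2g}` has no forced common node (d + i d_xy is generically fully gapped). [folklore] -/
theorem b2g_axis {g : Momentum → ℝ} (h : InChannel .B2g g) (t : ℝ) :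
    g (WithLp.toLp 2 ![t, 0]) = 0 ∧ g (WithLp.toLp 2 ![0, t]) = 0 := by
  have h1 := congrFun h (WithLp.toLp 2 ![t, 0])
  have h2 := congrFun h (WithLp.toLp 2 ![0, t])
  simp only [d4Project, sum_d4, d4_r0, d4_r1, d4_r2, d4_r3, d4_sr0, d4_sr1, d4_sr2, d4_sr3,
    D4Irrep.char, D4Irrep.dim, val0, val1, val2, val3, rot_mk, refl_mk, neg_neg, neg_zero] at h1 h2
  norm_num at h1 h2
  constructor <;> linarith

/-- A₂g (`xy(x²-y²)`) gap functions vanish on the diagonals AND the axes: an A₂g partner shares the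
four diagonal Fermi nodes of every B₁g function, so (iv) is impossible for `χs = A2g` with continuous
bottom eigenfunctions — the symmetry content of the crux's exclusion `χs ≠ A2g`. [folklore] -/
theorem a2g_diag_axis {g : Momentum → ℝ} (h : InChannel .A2g g) (t : ℝ) :
    g (WithLp.toLp 2 ![t, t]) = 0 ∧ g (WithLp.toLp 2 ![t, 0]) = 0 := by
  have h1 := congrFun h (WithLp.toLp 2 ![t, t])
  have h2 := congrFun h (WithLp.toLp 2 ![t, 0])
  simp only [d4Project, sum_d4, d4_r0, d4_r1, d4_r2, d4_r3, d4_sr0, d4_sr1, d4_sr2, d4_sr3,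
    D4Irrep.char, D4Irrep.dim, rot_mk, refl_mk, neg_neg, neg_zero] at h1 h2
  norm_num at h1 h2
  constructor <;> linarith

/-- Common node of every B₁g/A₂g pair at the diagonal points (why A₂g cannot be the chiral
partner). [folklore] -/
theorem b1g_a2g_common_node {g f : Momentum → ℝ} (hg : InChannel .B1g g) (hf : InChannel .A2g f)
    (t : ℝ) : g (WithLp.toLp 2 ![t, t]) ^ 2 + f (WithLp.toLp 2 ![t, t]) ^ 2 = 0 := by
  rw [b1g_diag hg t, (a2g_diag_axis hf t).1]; ring

/-- The E channel of the tree (`d4Project .E ψ = ψ`) is exactly the space of ODD gap functions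
(spin triplet); in particular it carries no forced zero on the Fermi curve (only at `k = 0`), and for
odd `ψ` the singlet kernel `U + U²χ₀(k+k')` acts as the triplet kernel `-U²χ₀(k-k')` (grounder note
2026-08-15). [folklore] -/
theorem e_iff_odd (g : Momentum → ℝ) : InChannel .E g ↔ ∀ k, g (-k) = -g k := by
  constructor
  · intro h k
    have h1 := congrFun h k
    simp only [d4Project, sum_d4, d4_r0, d4_r1, d4_r2, d4_r3, d4_sr0, d4_sr1, d4_sr2, d4_sr3,
      D4Irrep.char, D4Irrep.dim, ne10, ne12, ne20, ne30, ne32, if_false, rot_rot] at h1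
    norm_num at h1
    linarith
  · intro hodd
    funext k
    simp only [d4Project, sum_d4, d4_r0, d4_r1, d4_r2, d4_r3, d4_sr0, d4_sr1, d4_sr2, d4_sr3,
      D4Irrep.char, D4Irrep.dim, ne10, ne12, ne20, ne30, ne32, if_false, rot_rot, hodd]
    norm_num
    ring


end Summit.HubbardSuperconductivity.HubbardSuperconductivity.Theorems.CwKLChiralWindow.Negative

end
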